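import Literature.AnabelianGeometry.EtaleTheta.Discharge.Sec3Lemma35Holds
import Literature.AnabelianGeometry.EtaleTheta.Discharge.Sec3Remark351
import HarnessLib

/-!
# [EtTh] Lemma 3.5 (i), (ii) and Remark 3.5.1 over an ARBITRARY [FrdI]-vocabulary stub: the universal
# closures AS TYPED are false (kernel witnesses); instances of record at `treeMonoidVocab`

S. Mochizuki, *The étale theta function and its Frobenioid-theoretic manifestations*, Publ. RIMS **45**
(2009), §3, Lemma 3.5 (i), (ii) p. 75 and Remark 3.5.1 p. 76 [cite: MochizukiEtTh2009, Lem 3.5 p.75]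
[cite: MochizukiEtTh2009, Rmk 3.5.1 p.76].

PROOF-ONLY companion (no definitions) of `DivisorMonoids.lean` (seat abc-iut-L2-t3); cell abc-iut, block F,
seat abc-iut-f-045.  FACT-LIST rows **F-0732** `Lemma35_i`, **F-0522** `Lemma35_ii`, **F-0733** `Remark351`:
each decl is `FrdIMonoidStub → Prop`, i.e. parametric in the HYPOTHESIS STRUCTURE `V : FrdIMonoidStub` whose
fields (`IsPerfFactorial`, `IsRealification`, `RSupports`, `IsNonDilating`) are FREE predicates standing in
for the [FrdI] notions; the tree's discharges are at THE vocabulary of record `V := treeMonoidVocab`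
(`Lemma35_i_holds`, `Lemma35_ii_holds` — `Discharge/Sec3Lemma35Holds.lean`; `Remark351_holds` —
`Discharge/Sec3Remark351.lean`; weak variants at `treeMonoidVocabWeak`).  The R7 kernel TYPE-audit
(abc-iut-w5-d199 v2: «binders 0 vs 1») therefore found no theorem concluding the closures over ALL `V`, and
indeed they are FALSE at junk vocabularies:
* `not_forall_lemma35_i` — with `IsRealification := ⊤` any monoid `R` counts as "the realification" of
  `P = {1} ⊆ ℕ`, and the extension `R = ℕ → Q = ℕ` of `P ↪ Q` is not unique (`id` and the trivial map);
* `not_forall_lemma35_ii` — same junk, `Q = ℤ`, `R = ℕ ↪ ℤ`: the image `ℕ ⊆ ℤ` is not group-saturated;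
* `not_forall_remark351` — with `IsPerfFactorial := ⊥` the printed equivalence fails at the monoprime
  `P = Q = ℝ_{≥0}`.
So the three rows are admissible AT THE NAMED INSTANCE ONLY (R5); refuted-closure ≠ refuted-paper; a FACT row
is an assumption label, not an endorsement; nothing here bears on [IUTchIII] Cor. 3.12.
-/

namespace Literature.AnabelianGeometry.EtaleTheta

open Literature.AlgebraicGeometry.Frobenioids

/-- The trivial submonoid of any monoid is group-saturated ([EtTh] §0): `q · 1 = 1 ⇒ q = 1`.
[cite: MochizukiEtTh2009, §0 p.8] -/
theorem isGroupSaturated_bot (Q : Type*) [CommMonoid Q] : IsGroupSaturated (⊥ : Submonoid Q) := by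
  refine (isGroupSaturated_iff' _).2 fun q a ha b hb h => ?_
  rw [Submonoid.mem_bot] at ha hb ⊢
  rw [hb, mul_one] at h
  exact h.trans ha

/-- For `P = {1}` the compatibility "`ι ∘ ρ = (P ↪ Q)`" with the trivial `ρ : P → R` holds for EVERY
`ι : R → Q`. [cite: MochizukiEtTh2009, Lem 3.5 p.75] -/
theorem comp_one_eq_subtype_bot {Q R : Type*} [CommMonoid Q] [CommMonoid R] (ι : R →* Q) :
    ι.comp (1 : (⊥ : Submonoid Q) →* R) = (⊥ : Submonoid Q).subtype := by
  ext x
  rw [MonoidHom.comp_apply, MonoidHom.one_apply, map_one, Submonoid.coe_subtype,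
    Submonoid.mem_bot.mp x.2]

/-- **F-0732, universal closure REFUTED.**  At the junk vocabulary with all four predicates `⊤`,
`Lemma35_i V` fails: `Q = ℕ` (as `Multiplicative ℕ`), `P = {1}` (group-saturated), and the "realification"
`ρ : P → R := ℕ` (licensed by `IsRealification := ⊤`); both `id` and the trivial map `ℕ → ℕ` extend
`P ↪ Q` along `ρ`, so the uniqueness clause fails.  Instance of record: `Lemma35_i_holds`
(`V := treeMonoidVocab`). [cite: MochizukiEtTh2009, Lem 3.5 p.75] -/
theorem not_forall_lemma35_i : ¬ ∀ V : FrdIMonoidStub.{0}, Lemma35_i V := by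
  intro h
  let V : FrdIMonoidStub.{0} :=
    { IsPerfFactorial := fun _ _ => True
      IsRealification := fun _ _ _ _ _ => True
      RSupports := fun _ _ => True
      IsNonDilating := fun _ _ _ => True }
  obtain ⟨-, -, hrlf⟩ :=
    h V (Multiplicative ℕ) ⊥ trivial trivial (isGroupSaturated_bot _) trivial
  obtain ⟨⟨ι₀, -, huniq⟩, -⟩ :=
    hrlf (Multiplicative ℕ) (1 : (⊥ : Submonoid (Multiplicative ℕ)) →* Multiplicative ℕ) trivial
  have h1 : (MonoidHom.id (Multiplicative ℕ)) = ι₀ := huniq _ (comp_one_eq_subtype_bot _)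
  have h2 : (1 : Multiplicative ℕ →* Multiplicative ℕ) = ι₀ := huniq _ (comp_one_eq_subtype_bot _)
  have h3 := DFunLike.congr_fun (h1.trans h2.symm) (Multiplicative.ofAdd 1)
  rw [MonoidHom.id_apply, MonoidHom.one_apply] at h3
  exact absurd (congrArg Multiplicative.toAdd h3) (by decide)

/-- **F-0522, universal closure REFUTED.**  Same junk vocabulary, `Q = ℤ`, `P = {0}` (written
multiplicatively), "realification" `ρ : P → R := ℕ` and `ι : ℕ ↪ ℤ` the inclusion (compatible with `P ↪ Q`):
the image `ℕ ⊆ ℤ` is NOT group-saturated (`(−1) + 1 = 0` with `1, 0 ∈ ℕ`, `−1 ∉ ℕ`), so the realification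
clause of `Lemma35_ii V` fails.  Instance of record: `Lemma35_ii_holds` (`V := treeMonoidVocab`).
[cite: MochizukiEtTh2009, Lem 3.5 p.75] -/
theorem not_forall_lemma35_ii : ¬ ∀ V : FrdIMonoidStub.{0}, Lemma35_ii V := by
  intro h
  let V : FrdIMonoidStub.{0} :=
    { IsPerfFactorial := fun _ _ => True
      IsRealification := fun _ _ _ _ _ => True
      RSupports := fun _ _ => True
      IsNonDilating := fun _ _ _ => True }
  obtain ⟨-, hrlf⟩ := h V (Multiplicative ℤ) ⊥ trivial trivial (isGroupSaturated_bot _) trivial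
  let ι : Multiplicative ℕ →* Multiplicative ℤ := AddMonoidHom.toMultiplicative (Nat.castAddMonoidHom ℤ)
  have hsat : IsGroupSaturated (MonoidHom.mrange ι) :=
    hrlf (Multiplicative ℕ) (1 : (⊥ : Submonoid (Multiplicative ℤ)) →* Multiplicative ℕ) trivial ι
      (comp_one_eq_subtype_bot ι)
  have hmem : Multiplicative.ofAdd (-1 : ℤ) ∈ MonoidHom.mrange ι :=
    (isGroupSaturated_iff' _).1 hsat (Multiplicative.ofAdd (-1 : ℤ)) 1 (one_mem _)
      (ι (Multiplicative.ofAdd 1)) ⟨_, rfl⟩ (by rfl)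
  obtain ⟨n, hn⟩ := MonoidHom.mem_mrange.mp hmem
  have hn' : ((Multiplicative.toAdd n : ℕ) : ℤ) = -1 := by
    have := congrArg Multiplicative.toAdd hn
    simp [ι] at this
  omega

/-- **F-0733, universal closure REFUTED.**  At the junk vocabulary with `IsPerfFactorial := ⊥` (other
predicates `⊤`), `Remark351 V` fails at `Q = ℝ_{≥0}` (`ℝ`-monoprime), `P = Q ≠ {0}`: `P` IS monoprime (it is
`ℝ`-monoprime), but "`V`-perf-factorial and group-saturated" is false by fiat.  Instance of record:
`Remark351_holds` (`V := treeMonoidVocab`). [cite: MochizukiEtTh2009, Rmk 3.5.1 p.76] -/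
theorem not_forall_remark351 : ¬ ∀ V : FrdIMonoidStub.{0}, Remark351 V := by
  intro h
  let V : FrdIMonoidStub.{0} :=
    { IsPerfFactorial := fun _ _ => False
      IsRealification := fun _ _ _ _ _ => True
      RSupports := fun _ _ => True
      IsNonDilating := fun _ _ _ => True }
  have hQ : IsRMonoprime (Multiplicative NNReal) := ⟨⟨MulEquiv.refl _⟩⟩
  have htop : (⊤ : Submonoid (Multiplicative NNReal)) ≠ ⊥ := by
    intro htb
    have h1 : Multiplicative.ofAdd (1 : NNReal) ∈ (⊥ : Submonoid (Multiplicative NNReal)) :=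
      htb ▸ Submonoid.mem_top _
    rw [Submonoid.mem_bot] at h1
    exact one_ne_zero (congrArg Multiplicative.toAdd h1)
  have hmono : IsMonoprime (⊤ : Submonoid (Multiplicative NNReal)) :=
    IsMonoprime.ofR ⟨⟨Submonoid.topEquiv⟩⟩
  exact ((h V (Multiplicative NNReal) ⊤ hQ htop).mpr hmono).1

/-- The instances of record, restated as `example`s (nothing new): the three named facts HOLD at the
tree's [FrdI] vocabulary `treeMonoidVocab`. [cite: MochizukiEtTh2009, Lem 3.5 p.75] -/
example : Lemma35_i treeMonoidVocab.{0} ∧ Lemma35_ii treeMonoidVocab.{0} ∧ Remark351 treeMonoidVocab.{0} :=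
  ⟨Lemma35_i_holds, Lemma35_ii_holds, Remark351_holds⟩

end Literature.AnabelianGeometry.EtaleTheta
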